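import Summits.QuantumFields.YangMills.Theorems.IsotropyFromPowerCountingTemperedCurvatureMomentsOfBddRenormalisation

/-!
# `TemperedCurvatureMoments` (T, stmt-QuantumFields-17721), line `Sketch`: stub A3 `stub_temperedOfMeso`

The witness of the MESOSCOPIC REDUCTION of the crux `TemperedCurvatureMoments`.  Hypothesis MESO(n): there are
`C, N` such that for every physical scale `s ∈ (0,1]`, eventually in `k`, the TRUE renormalised density
`ρ_k(x) = c_kⁿ · W_k(x)` (`W_k = torusMoment`) is bounded by `C s^{-N}` at multi-sites `x` of the inner half-box
`box 4 (L_k/2)` with pairwise physical separations `‖a_k xᵢ − a_k xⱼ‖ ≥ s`.  Conclusion (the shape of T): lattice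
densities `D_k`, tempered at injective multi-sites of the full box uniformly in `k ≥ k₀`, whose Riemann sums
converge to `S₁ n P` on every separated compactly supported real product tensor `P = ⊗ᵢ fᵢ`.

The witness is the true density truncated outside the inner half-box and below a slowly vanishing dyadic scale
`s_k = 2^{-J(k)}`: `D_k x = ρ_k x` if all `xᵢ ∈ box 4 (L_k/2)` and all pairwise physical separations are `≥ s_k`,
else `0`.  The index `J` (`exists_slowIndex`) tends to infinity so slowly that `k ≥ k₀(2^{-j})` for every `j ≤ J k`:
then MESO at the dyadic scale just below the minimal separation (`exists_dyadic_le`,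
`2^{j'} ≤ 2 (1 + Σᵢ Σ_{j≠i} ‖yᵢ − yⱼ‖⁻¹)`) gives temperedness with constants `C 2^N, N`; and on a separated compactly
supported tensor the truncation is eventually invisible (all contributing multi-sites lie in the inner half-box,
`mem_box_of_norm_smul_le` + `eventually_le_mul_half`, and are `r`-separated with `r ≥ s_k`), so the Riemann sum
equals `latticeSchwinger` (`riemannSum_trueDensity_eq_latticeSchwinger`) and the tie gives the limit.

References: Osterwalder–Schrader 1973 §2; Glimm–Jaffe 1987 §9.5–9.6.
-/

noncomputable section

-- tree-known workaround (cf. the imported support file)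
attribute [-instance] SimplexCategory.instFintypeToTypeOrderHomFinHAddNatLenOfNat

namespace Summit.QuantumFields.YangMills.Theorems.TemperedCurvatureMoments.Sketch

open scoped BigOperators SchwartzMap Topology
open MeasureTheory Filter
open Literature.MathematicalPhysics.QuantumFieldTheory Literature.MathematicalPhysics.QuantumLattice
open Literature.MathematicalPhysics.AQFT
open Literature.Probability.LatticeModels (box mem_box Site)
open Summit.QuantumFields.YangMills.Theorems.OSLegsFromFemtoAndGap (torusMoment)
open Summit.QuantumFields.YangMills.Theorems.CurvatureBoostCovariance.Negative (Tie)
open Summit.QuantumFields.YangMills.Theorems.NPointIsotropy.Negative (E4)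
open Summit.QuantumFields.YangMills.Theorems.SoftKernelBoostCovariance.Sketch
  (riemannSum_trueDensity_eq_latticeSchwinger)

variable {G : Type} [Group G] [TopologicalSpace G] [IsTopologicalGroup G] [CompactSpace G]
  [MeasurableSpace G] [BorelSpace G]

/-! ## Bookkeeping: a slowly diverging index -/

/-- **Slow index.**  For any thresholds `k₀ : ℕ → ℕ` there are an index `J : ℕ → ℕ` tending to infinity and a
threshold `k₁` such that `k₀ j ≤ k` for every `j ≤ J k` once `k ≥ k₁` (take `K j = max_{j' ≤ j} k₀ j'` and
`J k` the largest `j ≤ k` with `K j ≤ k`). -/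
private theorem exists_slowIndex (k₀ : ℕ → ℕ) :
    ∃ (J : ℕ → ℕ) (k₁ : ℕ), (∀ k, k₁ ≤ k → ∀ j, j ≤ J k → k₀ j ≤ k) ∧ ∀ j, ∀ᶠ k in atTop, j ≤ J k := by
  classical
  set K : ℕ → ℕ := fun j => (Finset.range (j + 1)).sup k₀ with hK
  have hk₀K : ∀ j j', j' ≤ j → k₀ j' ≤ K j := fun j j' h =>
    Finset.le_sup (f := k₀) (Finset.mem_range.2 (Nat.lt_succ_of_le h))
  refine ⟨fun k => Nat.findGreatest (fun j => K j ≤ k) k, K 0, fun k hk j hj => ?_, fun j => ?_⟩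
  · have hspec : K (Nat.findGreatest (fun j => K j ≤ k) k) ≤ k :=
      Nat.findGreatest_spec (P := fun j => K j ≤ k) (Nat.zero_le k) hk
    exact (hk₀K _ _ hj).trans hspec
  · refine eventually_atTop.2 ⟨max j (K j), fun k hk => ?_⟩
    exact Nat.le_findGreatest (P := fun j => K j ≤ k) ((le_max_left _ _).trans hk)
      ((le_max_right _ _).trans hk)

/-- **Dyadic scale just below the minimal separation.**  If the points `y i` are pairwise `2^{-J}`-separated,
there is a dyadic scale `2^{-j'}`, `j' ≤ J`, still below all the separations, with
`2^{j'} ≤ 2 (1 + Σᵢ Σ_{j ≠ i} ‖yᵢ − yⱼ‖⁻¹)` (the least such `j'`: either `j' = 0`, or some pair is closer than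
`2^{-(j'-1)}`). -/
private theorem exists_dyadic_le {n : ℕ} (y : Fin n → E4) {J : ℕ}
    (hJ : ∀ i j, i ≠ j → ((2 : ℝ) ^ J)⁻¹ ≤ ‖y i - y j‖) :
    ∃ j' : ℕ, j' ≤ J ∧ (∀ i j, i ≠ j → ((2 : ℝ) ^ j')⁻¹ ≤ ‖y i - y j‖) ∧
      (2 : ℝ) ^ j' ≤ 2 * (1 + ∑ i, ∑ j ∈ Finset.univ.erase i, ‖y i - y j‖⁻¹) := by
  classical
  have hex : ∃ j' : ℕ, ∀ i j, i ≠ j → ((2 : ℝ) ^ j')⁻¹ ≤ ‖y i - y j‖ := ⟨J, hJ⟩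
  have hT : 0 ≤ ∑ i, ∑ j ∈ Finset.univ.erase i, ‖y i - y j‖⁻¹ :=
    Finset.sum_nonneg fun i _ => Finset.sum_nonneg fun j _ => inv_nonneg.2 (norm_nonneg _)
  refine ⟨Nat.find hex, Nat.find_min' hex hJ, Nat.find_spec hex, ?_⟩
  rcases Nat.eq_zero_or_pos (Nat.find hex) with h0 | hpos
  · rw [h0, pow_zero]
    linarith
  · obtain ⟨m, hm⟩ : ∃ m : ℕ, Nat.find hex = m + 1 := ⟨Nat.find hex - 1, by omega⟩
    have hmin : ¬ ∀ i j, i ≠ j → ((2 : ℝ) ^ m)⁻¹ ≤ ‖y i - y j‖ := Nat.find_min hex (by omega)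
    push Not at hmin
    obtain ⟨i, j, hij, hlt⟩ := hmin
    have hle : ((2 : ℝ) ^ Nat.find hex)⁻¹ ≤ ‖y i - y j‖ := Nat.find_spec hex i j hij
    have hpos' : 0 < ‖y i - y j‖ := lt_of_lt_of_le (by positivity) hle
    have h1 : (2 : ℝ) ^ m < ‖y i - y j‖⁻¹ := (lt_inv_comm₀ (by positivity) hpos').2 hlt
    have h2 : ‖y i - y j‖⁻¹ ≤ ∑ i, ∑ j ∈ Finset.univ.erase i, ‖y i - y j‖⁻¹ :=
      calc ‖y i - y j‖⁻¹ ≤ ∑ j ∈ Finset.univ.erase i, ‖y i - y j‖⁻¹ :=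
            Finset.single_le_sum (f := fun j => ‖y i - y j‖⁻¹) (fun j _ => inv_nonneg.2 (norm_nonneg _))
              (Finset.mem_erase.2 ⟨hij.symm, Finset.mem_univ j⟩)
        _ ≤ ∑ i, ∑ j ∈ Finset.univ.erase i, ‖y i - y j‖⁻¹ :=
            Finset.single_le_sum (f := fun i => ∑ j ∈ Finset.univ.erase i, ‖y i - y j‖⁻¹)
              (fun i _ => Finset.sum_nonneg fun j _ => inv_nonneg.2 (norm_nonneg _)) (Finset.mem_univ i)
    rw [hm, pow_succ]
    linarith

/-! ## Geometry: supports in a ball fit in the inner half-box -/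

/-- A site whose scaled image `a • x` has norm `≤ R ≤ a M` lies in `box 4 M` (coordinates are bounded by the
Euclidean norm). -/
private theorem mem_box_of_norm_smul_le (x : Site 4) {a R : ℝ} {M : ℕ} (ha : 0 < a)
    (hx : ‖a • siteToE x‖ ≤ R) (hM : R ≤ a * M) : x ∈ box 4 M := by
  rw [mem_box]
  intro ν
  have h1 : |a * (x ν : ℝ)| ≤ ‖a • siteToE x‖ := by
    have h := PiLp.norm_apply_le (a • siteToE x) ν
    rwa [PiLp.smul_apply, siteToE_apply, smul_eq_mul, Real.norm_eq_abs] at h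
  have h2 : |(x ν : ℝ)| ≤ M := by
    rw [abs_mul, abs_of_pos ha] at h1
    exact le_of_mul_le_mul_left (h1.trans (hx.trans hM)) ha
  rw [abs_le] at h2
  obtain ⟨h3, h4⟩ := h2
  exact ⟨by exact_mod_cast h3, by exact_mod_cast h4⟩

/-- Along a scheme, `R ≤ a_k ⌊L_k/2⌋` eventually (`a_k → 0` and `a_k L_k → ∞`). -/
private theorem eventually_le_mul_half {ι : Type} (sch : SpeciesScheme ι) (R : ℝ) :
    ∀ᶠ k in atTop, R ≤ sch.a k * ((sch.L k / 2 : ℕ) : ℝ) := by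
  have h1 : ∀ᶠ k in atTop, sch.a k ≤ 1 := sch.tendsto_a.eventually (eventually_le_nhds one_pos)
  have h2 : ∀ᶠ k in atTop, 2 * R + 1 ≤ sch.a k * sch.L k := sch.tendsto_L.eventually_ge_atTop _
  filter_upwards [h1, h2] with k hk1 hk2
  have ha := sch.a_pos k
  have h3 : (sch.L k : ℝ) ≤ 2 * ((sch.L k / 2 : ℕ) : ℝ) + 1 := by
    have h : sch.L k ≤ 2 * (sch.L k / 2) + 1 := by omega
    exact_mod_cast h
  have h4 : sch.a k * (sch.L k : ℝ) ≤ 2 * (sch.a k * ((sch.L k / 2 : ℕ) : ℝ)) + sch.a k :=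
    calc sch.a k * (sch.L k : ℝ) ≤ sch.a k * (2 * ((sch.L k / 2 : ℕ) : ℝ) + 1) :=
          mul_le_mul_of_nonneg_left h3 ha.le
      _ = 2 * (sch.a k * ((sch.L k / 2 : ℕ) : ℝ)) + sch.a k := by ring
  linarith

/-! ## Off-diagonality of separated tensors -/

/-- A real product tensor `P = ⊗ᵢ fᵢ` whose factors have pairwise `r`-separated supports, `r > 0`, is off-diagonal:
its support lies in the product of the supports, which misses the coincidence locus. -/
private theorem isOffDiagonal_of_separated {n : ℕ} {P : SchwartzMap (Fin n → E4) ℂ}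
    {f : Fin n → SchwartzMap E4 ℝ} (hP : IsTensorOf P (fun i => ofRealTest (f i))) {r : ℝ} (hr : 0 < r)
    (hsep : ∀ i j, i ≠ j → ∀ y ∈ tsupport (f i : E4 → ℝ), ∀ z ∈ tsupport (f j : E4 → ℝ), r ≤ ‖y - z‖) :
    IsOffDiagonal P := by
  refine IsOffDiagonal.of_tsupport_subset fun x hx hxc => ?_
  obtain ⟨i, j, hij, hxij⟩ := (mem_coincidenceLocus x).1 hxc
  have hsub : ∀ l, tsupport (ofRealTest (f l) : E4 → ℂ) ⊆ tsupport (f l : E4 → ℝ) := fun l => by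
    refine closure_mono fun y hy => ?_
    rw [Function.mem_support] at hy ⊢
    intro h0
    exact hy (by rw [ofRealTest_apply, h0, Complex.ofReal_zero])
  have hi : x i ∈ tsupport (f i : E4 → ℝ) := hsub i (hP.tsupport_subset hx i)
  have hj : x j ∈ tsupport (f j : E4 → ℝ) := hsub j (hP.tsupport_subset hx j)
  have h := hsep i j hij (x i) hi (x j) hj
  rw [hxij, sub_self, norm_zero] at h
  exact absurd h (not_le.2 hr)

/-! ## The stub -/

/-- **Stub A3 — the truncated true density (witness of the mesoscopic reduction).**  From the tie and MESO(n)
(`∃ C N, ∀ s ∈ (0,1], ∃ k₀, ∀ k ≥ k₀`: `|c_kⁿ W_k(x)| ≤ C s^{-N}` at multi-sites of the inner half-box with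
pairwise physical separations `≥ s`) there are lattice densities `D_k`, tempered at injective multi-sites of
the FULL box uniformly in `k ≥ k₀`, whose Riemann sums converge to `S₁ n P` on every separated compactly
supported real product tensor `P`.  Witness: `D_k x = c_kⁿ W_k x` if all `xᵢ ∈ box 4 (L_k/2)` and all pairwise
physical separations are `≥ s_k`, else `0`, with `s_k ↓ 0` so slowly that `k ≥ k₀(2^{-j})` for every dyadic
`2^{-j} ≥ s_k`; temperedness from MESO at the dyadic scale just below the minimal separation
(`s^{-N} ≤ 2^N (1 + Σ‖yᵢ − yⱼ‖⁻¹)^N`); on a separated compactly supported tensor the truncated Riemann sum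
EQUALS `latticeSchwinger` eventually (`riemannSum_trueDensity_eq_latticeSchwinger`), so the tie applies.
[folklore] -/
theorem stub_temperedOfMeso (r : LatticeRep G) (sch : SpeciesScheme (YMSpecies G))
    (S₁ : SchwingerFamily E4) (htie : Tie r sch S₁) {n : ℕ} (hn : 0 < n)
    (hmeso : ∃ (C : ℝ) (N : ℕ), 0 < C ∧ ∀ s : ℝ, 0 < s → s ≤ 1 → ∃ k₀ : ℕ, ∀ k : ℕ, k₀ ≤ k →
      ∀ x : Fin n → Site 4, (∀ i, x i ∈ box 4 (sch.L k / 2)) →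
        (∀ i j, i ≠ j → s ≤ ‖sch.a k • siteToE (x i) - sch.a k • siteToE (x j)‖) →
        |(sch.c r.curvature k) ^ n *
            torusMoment r.ρ (sch.β k) (sch.L k) r.curvature.F (sch.m r.curvature k) x| ≤ C * s⁻¹ ^ N) :
    ∃ (D : ℕ → (Fin n → Site 4) → ℝ) (C : ℝ) (N k₀ : ℕ), 0 < C ∧
      (∀ k : ℕ, k₀ ≤ k → ∀ x : Fin n → Site 4, (∀ i, x i ∈ box 4 (sch.L k)) → Function.Injective x →
        |D k x| ≤ C * (1 + ‖fun i => sch.a k • siteToE (x i)‖) ^ N *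
          (1 + ∑ i, ∑ j ∈ Finset.univ.erase i,
            ‖sch.a k • siteToE (x i) - sch.a k • siteToE (x j)‖⁻¹) ^ N) ∧
      ∀ (f : Fin n → SchwartzMap E4 ℝ) (P : SchwartzMap (Fin n → E4) ℂ),
        IsTensorOf P (fun i => ofRealTest (f i)) →
        (∃ r R : ℝ, 0 < r ∧ (∀ i, tsupport (f i : E4 → ℝ) ⊆ Metric.closedBall (0 : E4) R) ∧
          ∀ i j, i ≠ j → ∀ y ∈ tsupport (f i : E4 → ℝ), ∀ z ∈ tsupport (f j : E4 → ℝ), r ≤ ‖y - z‖) →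
        Tendsto (fun k => (((sch.a k ^ 4) ^ n *
          ∑ x ∈ Fintype.piFinset (fun _ : Fin n => box 4 (sch.L k)),
            (∏ i, f i (sch.a k • siteToE (x i))) * D k x : ℝ) : ℂ)) atTop (𝓝 (S₁ n P)) := by
  classical
  obtain ⟨C, N, hC, hmeso⟩ := hmeso
  -- MESO at the dyadic scales `2^{-j}`, thresholds `k₀ j`
  have hdy : ∀ j : ℕ, ∃ k₀ : ℕ, ∀ k : ℕ, k₀ ≤ k → ∀ x : Fin n → Site 4,
      (∀ i, x i ∈ box 4 (sch.L k / 2)) →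
      (∀ i i', i ≠ i' → ((2 : ℝ) ^ j)⁻¹ ≤ ‖sch.a k • siteToE (x i) - sch.a k • siteToE (x i')‖) →
      |(sch.c r.curvature k) ^ n *
          torusMoment r.ρ (sch.β k) (sch.L k) r.curvature.F (sch.m r.curvature k) x| ≤
        C * (((2 : ℝ) ^ j)⁻¹)⁻¹ ^ N :=
    fun j => hmeso _ (by positivity) (inv_le_one_of_one_le₀ (one_le_pow₀ one_le_two))
  choose k₀ hk₀ using hdy
  -- the slow index `J` and its threshold `k₁`
  obtain ⟨J, k₁, hJ, hJlim⟩ := exists_slowIndex k₀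
  refine ⟨fun k x => if (∀ i, x i ∈ box 4 (sch.L k / 2)) ∧
      (∀ i i', i ≠ i' → ((2 : ℝ) ^ J k)⁻¹ ≤ ‖sch.a k • siteToE (x i) - sch.a k • siteToE (x i')‖) then
      (sch.c r.curvature k) ^ n * torusMoment r.ρ (sch.β k) (sch.L k) r.curvature.F (sch.m r.curvature k) x
      else 0, C * 2 ^ N, N, k₁, by positivity, ?_, ?_⟩
  · -- temperedness, from MESO at the dyadic scale just below the minimal separation
    intro k hk x _ _
    dsimp only
    split_ifs with hgood
    · obtain ⟨hhalf, hsep⟩ := hgood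
      obtain ⟨j', hj'J, hj'sep, hj'le⟩ := exists_dyadic_le (fun i => sch.a k • siteToE (x i)) hsep
      have hb := hk₀ j' k (hJ k hk j' hj'J) x hhalf hj'sep
      rw [inv_inv] at hb
      have hT : 0 ≤ ∑ i, ∑ j ∈ Finset.univ.erase i, ‖sch.a k • siteToE (x i) - sch.a k • siteToE (x j)‖⁻¹ :=
        Finset.sum_nonneg fun i _ => Finset.sum_nonneg fun j _ => inv_nonneg.2 (norm_nonneg _)
      have hY : (1 : ℝ) ≤ (1 + ‖fun i => sch.a k • siteToE (x i)‖) ^ N :=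
        one_le_pow₀ (le_add_of_nonneg_right (norm_nonneg _))
      calc |(sch.c r.curvature k) ^ n *
              torusMoment r.ρ (sch.β k) (sch.L k) r.curvature.F (sch.m r.curvature k) x|
          ≤ C * ((2 : ℝ) ^ j') ^ N := hb
        _ ≤ C * (2 * (1 + ∑ i, ∑ j ∈ Finset.univ.erase i,
              ‖sch.a k • siteToE (x i) - sch.a k • siteToE (x j)‖⁻¹)) ^ N := by
            gcongr
        _ = C * 2 ^ N * 1 * (1 + ∑ i, ∑ j ∈ Finset.univ.erase i,
              ‖sch.a k • siteToE (x i) - sch.a k • siteToE (x j)‖⁻¹) ^ N := by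
            rw [mul_pow]; ring
        _ ≤ C * 2 ^ N * (1 + ‖fun i => sch.a k • siteToE (x i)‖) ^ N *
              (1 + ∑ i, ∑ j ∈ Finset.univ.erase i,
                ‖sch.a k • siteToE (x i) - sch.a k • siteToE (x j)‖⁻¹) ^ N := by
            gcongr
    · rw [abs_zero]
      positivity
  · -- convergence on separated compactly supported real product tensors: the truncation is eventually invisible
    rintro f P hP ⟨r₀, R, hr₀, hR, hsepf⟩
    have hPoff : IsOffDiagonal P := isOffDiagonal_of_separated hP hr₀ hsepf
    obtain ⟨j₀, hj₀⟩ : ∃ j₀ : ℕ, ((2 : ℝ) ^ j₀)⁻¹ < r₀ := by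
      obtain ⟨j₀, hj₀⟩ := exists_pow_lt_of_lt_one hr₀ (by norm_num : (2 : ℝ)⁻¹ < 1)
      exact ⟨j₀, by rwa [inv_pow] at hj₀⟩
    have hev : ∀ᶠ k in atTop, ((2 : ℝ) ^ J k)⁻¹ ≤ r₀ ∧ R ≤ sch.a k * ((sch.L k / 2 : ℕ) : ℝ) := by
      filter_upwards [hJlim j₀, eventually_le_mul_half sch R] with k hk1 hk2
      refine ⟨?_, hk2⟩
      calc ((2 : ℝ) ^ J k)⁻¹ ≤ ((2 : ℝ) ^ j₀)⁻¹ := inv_anti₀ (by positivity) (pow_le_pow_right₀ one_le_two hk1)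
        _ ≤ r₀ := hj₀.le
    refine (htie n hn.ne' f P hP hPoff).congr' ?_
    filter_upwards [hev] with k hk
    rw [← riemannSum_trueDensity_eq_latticeSchwinger r sch k n f P hP]
    congr 2
    refine Finset.sum_congr rfl fun x _ => ?_
    by_cases h0 : ∏ i, f i (sch.a k • siteToE (x i)) = 0
    · rw [h0, zero_mul, zero_mul]
    · have hne : ∀ i, f i (sch.a k • siteToE (x i)) ≠ 0 := fun i =>
        (Finset.prod_ne_zero_iff.1 h0) i (Finset.mem_univ i)
      have hsupp : ∀ i, sch.a k • siteToE (x i) ∈ tsupport (f i : E4 → ℝ) := fun i =>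
        subset_tsupport _ (Function.mem_support.2 (hne i))
      have hgood : (∀ i, x i ∈ box 4 (sch.L k / 2)) ∧
          ∀ i i', i ≠ i' → ((2 : ℝ) ^ J k)⁻¹ ≤ ‖sch.a k • siteToE (x i) - sch.a k • siteToE (x i')‖ :=
        ⟨fun i => mem_box_of_norm_smul_le (x i) (sch.a_pos k) (mem_closedBall_zero_iff.1 (hR i (hsupp i))) hk.2,
          fun i i' hii' => hk.1.trans (hsepf i i' hii' _ (hsupp i) _ (hsupp i'))⟩
      rw [if_pos hgood]

end Summit.QuantumFields.YangMills.Theorems.TemperedCurvatureMoments.Sketch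

end
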